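import Literature.AlgebraicGeometry.Motives.TorsorCoproductQuotient
import Literature.AlgebraicGeometry.Motives.FiniteQuotientQuasiProjective
import HarnessLib

/-!
# Separated quotients in STAGES: `Y → Y/N → Y/Δ` for `N ⊴ Δ`

Topic `AlgebraicGeometry/Motives`; namespace `Literature.AlgebraicGeometry.Motives`.  THEOREMS ONLY (no definition,
no named fact, no instance).

The tree's predicate `IsSepQuotient act p` (`Motives/SeparatedQuotient.lean`; API `hom_comp` / `existsUnique` /
`hom_ext` in `Motives/TorsorCoproductQuotient.lean`) says that the `k`-morphism `p : Y ⟶ Z` is a categorical quotient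
of `Y` by the family of `k`-automorphisms `act : Δ → (Y ≅ Y)` FOR SEPARATED TEST OBJECTS — Mumford's Remark
«`(Y, π)` is a categorical quotient» (*Abelian Varieties* §7, Theorem p. 66), SGA 1 V §1.  This file is the
COMPOSITION LAW of such quotients («passage au quotient par étapes»): if `Δ` acts on `Y`, `N ⊴ Δ`, `q : Y ⟶ W` is a
quotient by `N` and `p : Y ⟶ Z` a quotient by `Δ`, then `Δ/N` acts on `W`, `p` descends along `q` to
`p̄ : W ⟶ Z`, and `p̄` is a quotient of `W` by `Δ/N`; conversely a quotient by `N` followed by a quotient by `Δ/N` is a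
quotient by `Δ`.  Everything is pure category theory in `Over (Spec k)` on top of the three API lemmas; the geometry
(existence of quotients, Mumford's covering hypothesis) enters only in §3 through the tree's chosen quotient
`Motives.finiteQuotient` (`Motives/FiniteQuotient.lean`, `Motives/FiniteQuotientQuasiProjective.lean`).

* §1 BARE FAMILIES (no group structure; the two actions are compared through an arbitrary SURJECTION `π : Δ → Δ'`
  with `act g ≫ q = q ≫ act' (π g)`): `IsSepQuotient.of_stage` (a quotient by `Δ` descended along a quotient `q`
  is a quotient by `Δ'` — `q` is used only as an epimorphism against separated targets),
  `exists_desc_isSepQuotient_of_stage` (the descent exists as soon as `p` is invariant under the family `q` is a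
  quotient for), and the converse `IsSepQuotient.comp_stage` (quotient by the small family, then by `Δ'`, is a
  quotient by `Δ`, provided the small family consists of some of the `act g`).
* §2 GROUP FORM: `act : Δ →* Aut_k(Y)`, `N : Subgroup Δ` normal, `q` a quotient by `N` with `W` separated ⇒
  `exists_stageAction_of_isSepQuotient` — an action `actW : Δ ⧸ N →* Aut_k(W)` with `act g ≫ q = q ≫ actW ḡ`
  (descend `act g ≫ q`, which is `N`-invariant by normality; `map_one` / `map_mul` / «kills `N`» by cancellation of
  `q`; `QuotientGroup.lift`); `isSepQuotient_stage_quotientGroup`, `exists_desc_isSepQuotient_quotientGroup`,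
  the packaged `exists_stageAction_desc_isSepQuotient`, and the converse `isSepQuotient_comp_quotientGroup`.
* §3 `finiteQuotient` ISO FORM: if moreover `Δ'` is a finite group acting on the separated `W` with Mumford's
  covering hypothesis `hcov` (e.g. `W` quasi-projective: `ActionOver.forall_exists_stableAffineOpen_of_isQuasiProjectiveOver`),
  then `Z ≅ W/Δ'` under `W` (`exists_iso_finiteQuotient_stage`, `…_of_isQuasiProjectiveOver`) — the tree's
  `isoFiniteQuotient_of_isSepQuotient_of_cover` applied to §1.

Use (cell `hodgecm-mathlib`, fan B, rung B-I; banked generic capital toward row #60 `SiegelS1`, road R60-9): the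
transition morphisms of a Shimura tower built level by level as finite quotients (`M_{K''} → M_{K'} → M_K` for
`K'' ⊴ K' ⊴ K` of finite index, e.g. the principal Siegel levels `K_δ(N'') ≤ K_δ(N') ≤ K_δ(N)`, or the unitary
level changes of [Deligne1971TravauxShimura] Prop. 5.11) compose correctly and each is again a quotient map.
HC_CM is proved only modulo the 7 printed citations until rung 0 of the ladder closes; this file is unconditional.

Design: hypotheses are stated on bare families / `MonoidHom`s into `Aut`, exactly as the consumers of
`IsSepQuotient` in the tree phrase them (`fun g => act g`); separatedness is the RELATIVE `IsSeparated W.hom`.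
Deliberately NOT here: any statement about points, base change (`Motives/FiniteQuotientBaseChange.lean`), or
projectivity of quotients.

## References
* [MumfordAV1970] D. Mumford, *Abelian Varieties* (1970), §7 Theorem p. 66 and Remark (categorical quotient).
* [SGA1] A. Grothendieck, M. Raynaud, *SGA 1*, Exp. V §1, Prop. 1.1, Prop. 1.8 (quotients by finite groups).
* [MumfordFogartyKirwan1994] D. Mumford, J. Fogarty, F. Kirwan, *Geometric Invariant Theory*, 3rd ed., Ch. 0 §1
  Def. 0.5, §2 Prop. 0.1 (categorical quotients, uniqueness).
* [Deligne1971TravauxShimura] P. Deligne, *Travaux de Shimura*, Sém. Bourbaki 389 (1971), 1.8, Prop. 5.11.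
-/

noncomputable section

open CategoryTheory AlgebraicGeometry
open Literature.AlgebraicGeometry.RelativeSpec

namespace Literature.AlgebraicGeometry.Motives

universe u v v₀ v'

/-! ### §1 Stages for bare families of automorphisms -/

section Bare

variable {k : Type u} [Field k] {Δ : Type v} {Δ₀ : Type v₀} {Δ' : Type v'} {Y W Z : SchemeOver k}
  {act : Δ → (Y ≅ Y)} {act₀ : Δ₀ → (Y ≅ Y)} {act' : Δ' → (W ≅ W)} {q : Y ⟶ W} {p : Y ⟶ Z}

/-- If `act g ≫ q = q ≫ act' (π g)` for all `g`, then for every `act'`-invariant `f : W ⟶ V` the composite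
`q ≫ f` is `act`-invariant. [cite: MumfordAV1970, §7 Thm. p. 66 (Remark)] -/
theorem comp_invariant_of_stage (π : Δ → Δ') (hcomm : ∀ g : Δ, (act g).hom ≫ q = q ≫ (act' (π g)).hom)
    {V : SchemeOver k} {f : W ⟶ V} (hf : ∀ d : Δ', (act' d).hom ≫ f = f) (g : Δ) :
    (act g).hom ≫ q ≫ f = q ≫ f := by
  rw [← Category.assoc, hcomm g, Category.assoc, hf (π g)]

/-- If `act g ≫ q = q ≫ act' (π g)` for all `g` with `π` SURJECTIVE, `q` is a quotient for separated test objects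
(by any family `act₀`), and `p : Y ⟶ Z` is `act`-invariant with `Z` separated, then every `p̄ : W ⟶ Z` with
`q ≫ p̄ = p` is `act'`-invariant (cancel `q`). [cite: MumfordAV1970, §7 Thm. p. 66 (Remark)] -/
theorem desc_invariant_of_stage (hq : IsSepQuotient act₀ q) (hZ : IsSeparated Z.hom) (π : Δ → Δ')
    (hπ : Function.Surjective π) (hcomm : ∀ g : Δ, (act g).hom ≫ q = q ≫ (act' (π g)).hom)
    (hinv : ∀ g : Δ, (act g).hom ≫ p = p) {pbar : W ⟶ Z} (hpbar : q ≫ pbar = p) (d : Δ') :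
    (act' d).hom ≫ pbar = pbar := by
  obtain ⟨g, rfl⟩ := hπ d
  refine hq.hom_ext hZ ?_
  rw [← Category.assoc, ← hcomm g, Category.assoc, hpbar, hinv g]

/-- **Separated quotients in stages (descent).**  Let `act : Δ → (Y ≅ Y)` and `act' : Δ' → (W ≅ W)` be families
of `k`-automorphisms compared along `q : Y ⟶ W` through a SURJECTION `π : Δ → Δ'` (`act g ≫ q = q ≫ act' (π g)`),
let `q` be a quotient for separated test objects (by any family `act₀` — only «`q` is an epimorphism against
separated targets» is used) and `p : Y ⟶ Z` a quotient by `act` for separated test objects with `Z` separated.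
Then every `p̄ : W ⟶ Z` with `q ≫ p̄ = p` is a quotient of `W` by `act'` for separated test objects.  Proof:
invariance by cancelling `q`; an `act'`-invariant `f : W ⟶ V` gives the `act`-invariant `q ≫ f`, which factors
through `p` as `p ≫ f̄ = q ≫ f`, and `p̄ ≫ f̄ = f` after cancelling `q`; uniqueness by cancelling `p`.
[cite: MumfordAV1970, §7 Thm. p. 66 (Remark)] [cite: SGA1, Exp. V §1 Prop. 1.1] -/
theorem IsSepQuotient.of_stage (hp : IsSepQuotient act p) (hq : IsSepQuotient act₀ q) (hZ : IsSeparated Z.hom)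
    (π : Δ → Δ') (hπ : Function.Surjective π) (hcomm : ∀ g : Δ, (act g).hom ≫ q = q ≫ (act' (π g)).hom)
    {pbar : W ⟶ Z} (hpbar : q ≫ pbar = p) : IsSepQuotient act' pbar := by
  refine ⟨desc_invariant_of_stage hq hZ π hπ hcomm hp.hom_comp hpbar, fun V f hV hf => ?_⟩
  obtain ⟨fbar, hfbar, -⟩ := hp.existsUnique (q ≫ f) hV (comp_invariant_of_stage π hcomm hf)
  refine ⟨fbar, hq.hom_ext hV (by rw [← Category.assoc, hpbar, hfbar]), fun f' hf' => ?_⟩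
  exact hp.hom_ext hV (by rw [hfbar, ← hpbar, Category.assoc, hf'])

/-- **Separated quotients in stages (existence of the descent).**  Under the hypotheses of
`IsSepQuotient.of_stage`, if moreover `p` is invariant under the family `act₀` that `q` is a quotient for, then
`p` descends along `q` to a `p̄ : W ⟶ Z`, `q ≫ p̄ = p`, which is a quotient of `W` by `act'` for separated test
objects (and `p̄` is unique: `IsSepQuotient.hom_ext`). [cite: MumfordAV1970, §7 Thm. p. 66 (Remark)] -/
theorem exists_desc_isSepQuotient_of_stage (hp : IsSepQuotient act p) (hq : IsSepQuotient act₀ q)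
    (hZ : IsSeparated Z.hom) (π : Δ → Δ') (hπ : Function.Surjective π)
    (hcomm : ∀ g : Δ, (act g).hom ≫ q = q ≫ (act' (π g)).hom) (hinv₀ : ∀ n : Δ₀, (act₀ n).hom ≫ p = p) :
    ∃ pbar : W ⟶ Z, q ≫ pbar = p ∧ IsSepQuotient act' pbar := by
  obtain ⟨pbar, hpbar, -⟩ := hq.existsUnique p hZ hinv₀
  exact ⟨pbar, hpbar, hp.of_stage hq hZ π hπ hcomm hpbar⟩

/-- **Separated quotients in stages (composition).**  Let `act`, `act'` be compared along `q : Y ⟶ W` through a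
surjection `π` as above, let `q` be a quotient of `Y` by a family `act₀` each of whose members is one of the
`act g`, and let `p̄ : W ⟶ Z` be a quotient of `W` by `act'`, all for separated test objects.  Then `q ≫ p̄` is a
quotient of `Y` by `act` for separated test objects.  Proof: an `act`-invariant `f` is `act₀`-invariant, so it
descends along `q` to `f₁` with `q ≫ f₁ = f`; `f₁` is `act'`-invariant after cancelling `q`, so it descends along
`p̄`; uniqueness by cancelling `q` then `p̄`. [cite: MumfordAV1970, §7 Thm. p. 66 (Remark)] [cite: SGA1, Exp. V §1 Prop. 1.1] -/
theorem IsSepQuotient.comp_stage {pbar : W ⟶ Z} (hq : IsSepQuotient act₀ q) (hpbar : IsSepQuotient act' pbar)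
    (π : Δ → Δ') (hπ : Function.Surjective π) (hcomm : ∀ g : Δ, (act g).hom ≫ q = q ≫ (act' (π g)).hom)
    (hsub : ∀ n : Δ₀, ∃ g : Δ, (act₀ n).hom = (act g).hom) : IsSepQuotient act (q ≫ pbar) := by
  refine ⟨fun g => by rw [← Category.assoc, hcomm g, Category.assoc, hpbar.hom_comp (π g)],
    fun V f hV hf => ?_⟩
  have hf₀ : ∀ n : Δ₀, (act₀ n).hom ≫ f = f := fun n => by
    obtain ⟨g, hg⟩ := hsub n
    rw [hg, hf g]
  obtain ⟨f₁, hf₁, -⟩ := hq.existsUnique f hV hf₀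
  have hf₁' : ∀ d : Δ', (act' d).hom ≫ f₁ = f₁ := fun d => by
    obtain ⟨g, rfl⟩ := hπ d
    refine hq.hom_ext hV ?_
    rw [← Category.assoc, ← hcomm g, Category.assoc, hf₁, hf g]
  obtain ⟨f₂, hf₂, -⟩ := hpbar.existsUnique f₁ hV hf₁'
  refine ⟨f₂, ?_, fun f' hf' => ?_⟩
  · show (q ≫ pbar) ≫ f₂ = f
    rw [Category.assoc, hf₂, hf₁]
  · have hf' : (q ≫ pbar) ≫ f' = f := hf'
    refine hpbar.hom_ext hV (hq.hom_ext hV ?_)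
    simp only [Category.assoc] at hf'
    rw [hf', hf₂, hf₁]

end Bare

/-! ### §2 Group form: `act : Δ →* Aut_k(Y)`, `N ⊴ Δ`, the induced action of `Δ ⧸ N` on `Y/N` -/

section Group

variable {k : Type u} [Field k] {Δ : Type v} [Group Δ] (N : Subgroup Δ) [N.Normal] {Y W Z : SchemeOver k}
  (act : Δ →* Aut Y) {q : Y ⟶ W}

/-- For `N ⊴ Δ` and `q : Y ⟶ W` invariant under `N`, every `act g ≫ q` (`g : Δ`) is again `N`-invariant:
`act n ≫ act g = act g ≫ act (g n g⁻¹)`. [cite: SGA1, Exp. V §1 Prop. 1.1] -/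
theorem hom_comp_hom_comp_eq_of_normal (hq : ∀ n : N, (act (n : Δ)).hom ≫ q = q) (g : Δ) (n : N) :
    (act (n : Δ)).hom ≫ (act g).hom ≫ q = (act g).hom ≫ q := by
  have hn' : g * n * g⁻¹ ∈ N := ‹N.Normal›.conj_mem _ n.2 g
  have hmul : (act (n : Δ)).hom ≫ (act g).hom = (act g).hom ≫ (act (g * n * g⁻¹)).hom := by
    rw [← Iso.trans_hom, ← Iso.trans_hom, ← Aut.Aut_mul_def, ← Aut.Aut_mul_def, ← map_mul, ← map_mul,
      inv_mul_cancel_right]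
  rw [← Category.assoc, hmul, Category.assoc, hq ⟨_, hn'⟩]

/-- **The induced action on the intermediate quotient.**  `act : Δ →* Aut_k(Y)`, `N ⊴ Δ`, `q : Y ⟶ W` a quotient
of `Y` by `N` for separated test objects, `W` separated over `k` ⇒ there is an action `actW : Δ ⧸ N →* Aut_k(W)`
with `act g ≫ q = q ≫ actW ḡ` for every `g : Δ`.  Construction: `act g ≫ q` is `N`-invariant (normality), so it
descends along `q` to `T g : W ⟶ W`; `T 1 = 𝟙`, `T (g h) = T h ≫ T g` and `T n = 𝟙` (`n ∈ N`) by cancelling `q`,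
so `g ↦ T g` is a homomorphism `Δ →* Aut_k(W)` killing `N`, and `QuotientGroup.lift` finishes.
[cite: SGA1, Exp. V §1 Prop. 1.1] [cite: MumfordAV1970, §7 Thm. p. 66 (Remark)] -/
theorem exists_stageAction_of_isSepQuotient (hq : IsSepQuotient (fun n : N => act (n : Δ)) q)
    (hW : IsSeparated W.hom) :
    ∃ actW : Δ ⧸ N →* Aut W, ∀ g : Δ, (act g).hom ≫ q = q ≫ (actW (g : Δ ⧸ N)).hom := by
  have hinv : ∀ (g : Δ) (n : N), (act (n : Δ)).hom ≫ (act g).hom ≫ q = (act g).hom ≫ q :=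
    hom_comp_hom_comp_eq_of_normal N act hq.hom_comp
  -- the descended endomorphisms `T g : W ⟶ W`, `q ≫ T g = act g ≫ q`
  obtain ⟨T, hT⟩ : ∃ T : Δ → (W ⟶ W), ∀ g : Δ, q ≫ T g = (act g).hom ≫ q :=
    ⟨fun g => (hq.existsUnique ((act g).hom ≫ q) hW (hinv g)).exists.choose,
      fun g => (hq.existsUnique ((act g).hom ≫ q) hW (hinv g)).exists.choose_spec⟩
  have hT1 : T 1 = 𝟙 W := hq.hom_ext hW (by rw [hT, map_one, Category.comp_id]; rfl)
  have hTmul : ∀ g h : Δ, T (g * h) = T h ≫ T g := fun g h => hq.hom_ext hW (by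
    rw [hT, map_mul, Aut.Aut_mul_def, Iso.trans_hom, Category.assoc, ← hT g, ← Category.assoc, ← hT h,
      Category.assoc])
  have hTN : ∀ n : N, T (n : Δ) = 𝟙 W := fun n => hq.hom_ext hW (by
    rw [hT, Category.comp_id]; exact hq.hom_comp n)
  -- as isomorphisms and as a homomorphism `Δ →* Aut W`
  have hTinv₁ : ∀ g : Δ, T g ≫ T g⁻¹ = 𝟙 W := fun g => by rw [← hTmul, inv_mul_cancel, hT1]
  have hTinv₂ : ∀ g : Δ, T g⁻¹ ≫ T g = 𝟙 W := fun g => by rw [← hTmul, mul_inv_cancel, hT1]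
  let Tiso : Δ → Aut W := fun g => ⟨T g, T g⁻¹, hTinv₁ g, hTinv₂ g⟩
  let ρW : Δ →* Aut W :=
    { toFun := Tiso
      map_one' := Iso.ext hT1
      map_mul' := fun g h => Iso.ext (by rw [Aut.Aut_mul_def, Iso.trans_hom]; exact hTmul g h) }
  have hker : N ≤ ρW.ker := fun n hn => by
    rw [MonoidHom.mem_ker]
    exact Iso.ext (hTN ⟨n, hn⟩)
  refine ⟨QuotientGroup.lift N ρW hker, fun g => ?_⟩
  rw [QuotientGroup.lift_mk]
  exact (hT g).symm

variable {N act}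

/-- **Stages, group form (descent).**  With `actW : Δ ⧸ N →* Aut_k(W)` compatible with `act` along the
`N`-quotient `q` (`act g ≫ q = q ≫ actW ḡ`, e.g. from `exists_stageAction_of_isSepQuotient`) and `p : Y ⟶ Z` a
quotient of `Y` by `Δ` for separated test objects, `Z` separated: every `p̄ : W ⟶ Z` with `q ≫ p̄ = p` is a quotient
of `W` by `Δ ⧸ N` for separated test objects. [cite: SGA1, Exp. V §1 Prop. 1.1] [cite: MumfordAV1970, §7 Thm. p. 66 (Remark)] -/
theorem isSepQuotient_stage_quotientGroup {actW : Δ ⧸ N →* Aut W}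
    (hactW : ∀ g : Δ, (act g).hom ≫ q = q ≫ (actW (g : Δ ⧸ N)).hom)
    (hq : IsSepQuotient (fun n : N => act (n : Δ)) q) {p : Y ⟶ Z} (hp : IsSepQuotient (fun g => act g) p)
    (hZ : IsSeparated Z.hom) {pbar : W ⟶ Z} (hpbar : q ≫ pbar = p) :
    IsSepQuotient (fun d => actW d) pbar :=
  hp.of_stage hq hZ (QuotientGroup.mk : Δ → Δ ⧸ N) QuotientGroup.mk_surjective hactW hpbar

/-- **Stages, group form (existence of the descent).**  Same data: `p` descends along `q` to a `p̄ : W ⟶ Z` with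
`q ≫ p̄ = p`, and `p̄` is a quotient of `W` by `Δ ⧸ N` for separated test objects.
[cite: SGA1, Exp. V §1 Prop. 1.1] [cite: MumfordAV1970, §7 Thm. p. 66 (Remark)] -/
theorem exists_desc_isSepQuotient_quotientGroup {actW : Δ ⧸ N →* Aut W}
    (hactW : ∀ g : Δ, (act g).hom ≫ q = q ≫ (actW (g : Δ ⧸ N)).hom)
    (hq : IsSepQuotient (fun n : N => act (n : Δ)) q) {p : Y ⟶ Z} (hp : IsSepQuotient (fun g => act g) p)
    (hZ : IsSeparated Z.hom) :
    ∃ pbar : W ⟶ Z, q ≫ pbar = p ∧ IsSepQuotient (fun d => actW d) pbar :=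
  exists_desc_isSepQuotient_of_stage hp hq hZ (QuotientGroup.mk : Δ → Δ ⧸ N) QuotientGroup.mk_surjective hactW
    fun n => hp.hom_comp (n : Δ)

/-- **Separated quotients in stages, packaged**: `act : Δ →* Aut_k(Y)`, `N ⊴ Δ`, `q : Y ⟶ W` a quotient by `N`
and `p : Y ⟶ Z` a quotient by `Δ`, both for separated test objects, `W` and `Z` separated over `k` ⇒ `Δ ⧸ N` acts
on `W` compatibly with `act` along `q`, and `p` descends along `q` to a quotient `p̄ : W ⟶ Z` of `W` by `Δ ⧸ N`
(«`(Y/N)/(Δ/N) = Y/Δ`»). [cite: SGA1, Exp. V §1 Prop. 1.1] [cite: MumfordAV1970, §7 Thm. p. 66 (Remark)] -/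
theorem exists_stageAction_desc_isSepQuotient (hq : IsSepQuotient (fun n : N => act (n : Δ)) q)
    (hW : IsSeparated W.hom) {p : Y ⟶ Z} (hp : IsSepQuotient (fun g => act g) p) (hZ : IsSeparated Z.hom) :
    ∃ (actW : Δ ⧸ N →* Aut W) (pbar : W ⟶ Z),
      (∀ g : Δ, (act g).hom ≫ q = q ≫ (actW (g : Δ ⧸ N)).hom) ∧ q ≫ pbar = p ∧
        IsSepQuotient (fun d => actW d) pbar := by
  obtain ⟨actW, hactW⟩ := exists_stageAction_of_isSepQuotient N act hq hW
  obtain ⟨pbar, hpbar, h⟩ := exists_desc_isSepQuotient_quotientGroup hactW hq hp hZ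
  exact ⟨actW, pbar, hactW, hpbar, h⟩

/-- **Stages, group form (composition).**  `q : Y ⟶ W` a quotient by `N`, `actW : Δ ⧸ N →* Aut_k(W)` compatible
with `act` along `q`, and `p̄ : W ⟶ Z` a quotient of `W` by `Δ ⧸ N`, all for separated test objects ⇒ `q ≫ p̄` is a
quotient of `Y` by `Δ`. [cite: SGA1, Exp. V §1 Prop. 1.1] [cite: MumfordAV1970, §7 Thm. p. 66 (Remark)] -/
theorem isSepQuotient_comp_quotientGroup {actW : Δ ⧸ N →* Aut W}
    (hactW : ∀ g : Δ, (act g).hom ≫ q = q ≫ (actW (g : Δ ⧸ N)).hom)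
    (hq : IsSepQuotient (fun n : N => act (n : Δ)) q) {pbar : W ⟶ Z}
    (hpbar : IsSepQuotient (fun d => actW d) pbar) : IsSepQuotient (fun g => act g) (q ≫ pbar) :=
  hq.comp_stage hpbar (QuotientGroup.mk : Δ → Δ ⧸ N) QuotientGroup.mk_surjective hactW fun n => ⟨(n : Δ), rfl⟩

end Group

/-! ### §3 The `finiteQuotient` iso form: `Z ≅ W/Δ'` under `W` -/

section Iso

variable {k : Type u} [Field k] {Δ : Type v} {Δ₀ : Type v₀} {Δ' : Type} [Group Δ'] [Finite Δ']
  {Y W Z : SchemeOver k} {act : Δ → (Y ≅ Y)} {act₀ : Δ₀ → (Y ≅ Y)} {q : Y ⟶ W} {p : Y ⟶ Z}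

/-- **Stages, `finiteQuotient` form.**  In the situation of `IsSepQuotient.of_stage` with `Δ'` a FINITE GROUP
acting by `act' : Δ' →* Aut_k(W)` on the separated `W` whose `Δ'`-stable affine opens cover it (Mumford's
hypothesis), the far quotient `Z` is the tree's chosen quotient `W/Δ' = finiteQuotient` under `W`: there is an
isomorphism `i : Z ≅ W/Δ'` with `p̄ ≫ i.hom = (W ⟶ W/Δ')`.  (`isoFiniteQuotient_of_isSepQuotient_of_cover` on §1.)
[cite: MumfordAV1970, §7 Thm. p. 66 (Remark)] [cite: SGA1, Exp. V §1 Prop. 1.8] -/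
theorem exists_iso_finiteQuotient_stage [IsSeparated W.hom] (act' : Δ' →* Aut W)
    (hcov : ∀ w : W.left, ∃ O : (⟨((Over.forget _).mapAut W).comp act', fun d => Over.w (act' d).hom⟩ :
        ActionOver W.hom Δ').StableAffineOpens, w ∈ O.1)
    (hp : IsSepQuotient act p) (hq : IsSepQuotient act₀ q) (hZ : IsSeparated Z.hom) (π : Δ → Δ')
    (hπ : Function.Surjective π) (hcomm : ∀ g : Δ, (act g).hom ≫ q = q ≫ (act' (π g)).hom)
    {pbar : W ⟶ Z} (hpbar : q ≫ pbar = p) :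
    ∃ i : Z ≅ finiteQuotient (⟨((Over.forget _).mapAut W).comp act', fun d => Over.w (act' d).hom⟩ :
        ActionOver W.hom Δ'),
      pbar ≫ i.hom = finiteQuotient.mk _ hcov :=
  isoFiniteQuotient_of_isSepQuotient_of_cover act' hcov pbar hZ (hp.of_stage hq hZ π hπ hcomm hpbar)

/-- **Stages, `finiteQuotient` form, quasi-projective intermediate quotient**: as
`exists_iso_finiteQuotient_stage`, Mumford's covering hypothesis being discharged by quasi-projectivity of `W`
(`ActionOver.forall_exists_stableAffineOpen_of_isQuasiProjectiveOver`; SGA 1 V Prop. 1.8 «le quotient existe si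
`X` est quasi-projectif»). [cite: SGA1, Exp. V §1 Prop. 1.8] [cite: MumfordAV1970, §7 Thm. p. 66 (Remark)] -/
theorem exists_iso_finiteQuotient_stage_of_isQuasiProjectiveOver [IsSeparated W.hom]
    (hW : HodgeTheory.IsQuasiProjectiveOver W) (act' : Δ' →* Aut W)
    (hp : IsSepQuotient act p) (hq : IsSepQuotient act₀ q) (hZ : IsSeparated Z.hom) (π : Δ → Δ')
    (hπ : Function.Surjective π) (hcomm : ∀ g : Δ, (act g).hom ≫ q = q ≫ (act' (π g)).hom)
    {pbar : W ⟶ Z} (hpbar : q ≫ pbar = p) :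
    ∃ i : Z ≅ finiteQuotient (⟨((Over.forget _).mapAut W).comp act', fun d => Over.w (act' d).hom⟩ :
        ActionOver W.hom Δ'),
      pbar ≫ i.hom =
        finiteQuotient.mk _ (ActionOver.forall_exists_stableAffineOpen_of_isQuasiProjectiveOver _ hW) :=
  exists_iso_finiteQuotient_stage act' _ hp hq hZ π hπ hcomm hpbar

end Iso

end Literature.AlgebraicGeometry.Motives

end
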